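/-
Origin: expansion seat `planner-pub-hodgecm-prl1-g3-0`, handover #14 2026-08-18T06:44:30Z (`HOME/pub-hodgecm-prl1-g3/lean/Prl1g3/ModelCarrierCompact.lean`, md5 269d8c17, 74 lines);
landed by the gen-7 packager in gate run 25 as `HodgeCM/Automorphic/ModelCarrierCompact.lean` (import ^import Prl1g3\.→import HodgeCM.Automorphic. ×1).
-/
/-
Origin: expansion seat `planner-pub-hodgecm-prl1-g3-0` (unit pub-hodgecm-prl1-g3, EXPANSION PROVER a-1 gen 3, CONSTRUCT),
2026-08-18.  Suggested target: `HodgeCM/Automorphic/ModelCarrierCompact.lean` (module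
`HodgeCM.Automorphic.ModelCarrierCompact`; ADDITIVE; ONE WIP import to rewrite:
`import Prl1g3.ModelCarrier` ↦ `import HodgeCM.Automorphic.ModelCarrier`).
-/
import Summits.HodgeConjecture.HodgeCM.Automorphic.ModelCarrier

/-!
# The `G_U` side as a compact quotient too: the discrete-part model loses nothing

`ModelCarrier` models PerL's `L²_disc([G_U])` as the discrete part `RepDecomp.discPart R_U` of an ARBITRARY
representation `R_U` (`DiscModel`), which makes `hatτ_complete` a theorem with no hypothesis on `R_U`.

In the programme's situation the `G_U` side is itself a compact quotient: `G_U = U(V)` for the hermitian space `V`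
of signature `(2,1)` at `ι₁|_{L⁺}` and DEFINITE at the other real places of `L⁺` (there are others:
`[L:ℚ] ∈ {24, 48}`), so `U(V)` is anisotropic over `L⁺` and `[G_U] = U(V)(L⁺)\U(V)(𝔸_{L⁺})` is compact — the
same reason PerL v5 ll. 384–385 gives for `[U(W)]`, and the reason the Picard modular surfaces `P_Γ = Γ\𝔹²` of
this programme are smooth PROJECTIVE surfaces (`Universe.pms … : U.Var`).  This file records, as kernel theorems:

* `QuotientModel.toDiscModel` — a `QuotientModel` (compact Haar quotient) IS a `DiscModel`, with
* `QuotientModel.discPart_R_eq_top` — its discrete part is EVERYTHING: `discPart (ρHom ν) = ⊤`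
  (pv06-g3's compact approximation + the Gelfand–Graev–Piatetski-Shapiro argument, `QuotientModel.discreteDecomp_R`);
* `QuotientModel.iSup_isotypic_R` — equivalently the isotypic components of `L²(G_U ⧸ Γ_U)` have dense span, i.e.
  PerL's AX1b(a) `hatτ_complete` holds for the FULL `L²([G_U])` of a compact quotient, not only for its discrete part.

So a modeller who takes `disc := (Q_U).toDiscModel` in `ModelThetaData` gets `HG = discPart = ⊤ ≅ L²(G_U ⧸ Γ_U)`:
nothing of `L²([G_U])` is discarded.  (For seats modelling `[G_U]` directly as a compact measured space — e.g. the
kernel-model carriers — the recipe for their `hatτ_complete` is: give `[G_U]` as a compact Haar quotient, take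
`SigIdxG := RepDecomp.IsoClass (ρHom ν_U)`, `hatτ := RepDecomp.isotypic (ρHom ν_U)`, and apply `iSup_isotypic_R`.)
-/

noncomputable section

open MeasureTheory

attribute [-instance] Quotient.instMeasurableSpace

namespace HodgeCM

namespace QuotientModel

variable (Q : QuotientModel)

/-- **A compact Haar quotient is a `G_U`-side model**: `HU := L²(G ⧸ Γ, ν)`, `RU :=` the regular representation. -/
def toDiscModel : DiscModel where
  HU := Q.H
  GU := Q.G
  RU := Q.R

/-- (Ported verbatim from the HodgeCMPerL package; no docstring in the source.) -/
@[simp] theorem toDiscModel_RU : Q.toDiscModel.RU = Q.R := rfl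

/-- **The discrete part of `L²` of a compact Haar quotient is everything.** -/
theorem discPart_R_eq_top : RepDecomp.discPart Q.R = ⊤ := Q.discreteDecomp_R

/-- The same for the `DiscModel` it defines: `HG = discPart = ⊤`. -/
theorem discPart_toDiscModel_eq_top : RepDecomp.discPart Q.toDiscModel.RU = ⊤ := Q.discreteDecomp_R

/-- **AX1b(a) for the full `L²` of a compact quotient**: the isotypic components of the regular representation of
`L²(G ⧸ Γ, ν)` have dense span. -/
theorem iSup_isotypic_R : (⨆ c, RepDecomp.isotypic Q.R c).topologicalClosure = ⊤ :=
  RepDecomp.iSup_isotypic_complete_of_compactApprox Q.isUnitaryRep_R Q.hasCompactApprox_R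

/-- Every irreducible closed invariant subspace of `L²(G ⧸ Γ, ν)` lies in (indeed: everything lies in) the discrete
part — the trivial direction, recorded for symmetry with `RepDecomp.isEmpty_irr_contPart`. -/
theorem irr_le_discPart (V : RepDecomp.Irr Q.R) : (V.1 : Submodule ℂ Q.H) ≤ RepDecomp.discPart Q.R := by
  rw [discPart_R_eq_top]
  exact le_top

end QuotientModel

end HodgeCM

end
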